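/-
Copyright: statement-level skeleton of a published paper (lit-balaban cell, Phase-2 proof seat p39 gen 7). No proof claims
beyond what the kernel checks below.
-/
import Literature.MathematicalPhysics.QuantumFieldTheory.Balaban1983to89.B3MxiDifferenceProfiles

/-!
# B3 — T. Bałaban, *(Higgs)₂,₃ quantum fields in a finite volume. III. Renormalization*, CMP **88** (1983) 411–445
[Balaban1983Higgs3], p. 441 [PDF 31] with (3.16) p. 437 [PDF 27]: the difference kernel `M = G^ξ_k(0) − C^ξ_T =
ξ^d·G^ξ_k(0)(1 − m²_{j″} − a_{j″}P_{j″})C^ξ_T` of *"Next we replace the propagator G_{j₀}(0) by C^ξ, ξ = L^{−j₀}, using the same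
equation as in (3.16). If at least one propagator G_{j₀}(0) is replaced by G_{j₀}(0)(1 − m²_{j₀} − a_{j₀}P_{j₀})C^ξ, then we get a
convergent expression."* — file 2 of 2 after `B3MxiDifferenceProfiles`: the FUBINI FORM of the mechanism,
`|Σ_{x′}ξ^d(M∂^{ξ*}_{μ′})(x,x′)κ(x′,x)| ≤ C·b` for every kernel `κ` with the derivative profile `b(ξ·max(1,|x′−x|))^{−2}e^{−δξ|x′−x|}`
(the `x′`-sum done first is a SHARP composition of two derivative profiles), which bounds the (3.26) cross terms
`(M∂^*_{μ′})(x,x′)(G∂^*_μ)(x′,x)` whose two factors are not separately summable with the right power; and the hypothesis-free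
package of all kernel bounds of `M` at the zero-field torus instance, `d = 3`, uniformly in the volume

statement-level skeleton of published theorems with citation tags; proofs where landed; nothing here is a claim about
the Yang–Mills mass gap

PDF held: `paper:balaban1983-higgs-2-3-quantum-fields-finite-volume` (journal page = PDF page + 410); pp. 437, 441 read on the
×2 renders `run/shared/lean/pub/pub-balaban/b2b-balaban-ref1/pages/1983-cmp88-higgs23-III/1983-cmp88-higgs23-III-p027-x2.png`,
`…-p031-x2.png`.  Row **B3.Eq3.25-3.32** of `HOME/lit-balaban-r15/ROWS-B3.md` (fold owner r15).  Inputs BY NAME: gen 6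
`B3Eq323CrossTermsZeroTorus.d1Kernel_Mxi`, `abs_Mxi_le`, `abs_CxiT_profile`, `B3Eq316ResolventZeroTorus.Dmid`; gen 7
`G0xi_all_bounds`, `abs_Dmid_smear_one_le`, `conv22_le`, `B3MxiDifferenceProfiles.{Dmid_symm, dAdjKernel_Mxi_eq, abs_d1Kernel_Mxi_le,
abs_d2Kernel_Mxi_le}`.
* §1 **`abs_sum_d1Mxi_mul_le`** / **`abs_sum_dAdjMxi_mul_le`**: the Fubini form with explicit constants.
* §2 **`Mxi_profiles`**: `∃ δ C > 0` uniform in `P = (3,L,m,K)`, `1 ≤ k ≤ K`: `|M| ≤ C`; `|∂_μM|, |M∂^*_μ|, |∂_{μ′}M∂^*_μ| ≤ C·P₁`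
  (`P_p(y,y′) = (ξ·max(1,|y−y′|))^{−p}e^{−δξ|y−y′|}`); the Fubini bounds `≤ C·b` for every `κ` with `|κ(x′,x)| ≤ b·P₂(x′,x)`.
HONEST SCOPE: the model instance `A = B̃ = 0`, `U ≡ 1`, `Ω` = the whole torus, `d = 3`; sup torus distance; constants explicit in §1,
existential (functions of `L, a, m²`) in §2.  Mathlib + the cited tree files only; theorems only, no definitions, no named facts;
standard axioms.  Unit `lit-balaban-p39-g7` (Phase-2 proof seat p39, gen 7), HOME `run/shared/lean/pub/lit-balaban/`, 2026-08-21.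
-/

open scoped BigOperators

namespace Literature.MathematicalPhysics.QuantumFieldTheory.Balaban1983to89.B3MxiFubiniBound

open Matrix Finset B1RG242Torus B3GkZeroTorusRescaled B3Eq316ResolventZeroTorus B3KernelConvolutionTorus
open B3KernelConvolutionTorusSup B3Bound316ZeroTorus B3Eq323CrossTermsZeroTorus B3KernelBlockSmearing
open LatticeFieldCalculus B3Sect3ScalarSelfEnergy B3TorusRadialSums B3Bound316 B3CxiTorusBound
open B3ZeroTorusKernelProfiles B3KernelConvolutionTorusSharp B3KernelConvolutionTorusOneTwo B3MxiDifferenceProfiles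
open B3Sect3VectorSelfEnergy (dAdjKernel d2Kernel)

noncomputable section

variable {P : Params}

/-! ## §1 The Fubini form -/

section Bounds

variable {a msq : ℝ} {k : ℕ} {δ C_G : ℝ}

/-- kernel: the triple sum behind the Fubini form, `Σ_{x′}w((wΣ_{z′}(Σ_zA(x′,z)D(z,z′))c(z′))κ(x′)) =
w·Σ_{z′}(Σ_z(Σ_{x′}w·A(x′,z)κ(x′))D(z,z′))c(z′)` (finite sums commute). [folklore] -/
private theorem fubini3 {ι : Type*} [Fintype ι] (w : ℝ) (A D : ι → ι → ℝ) (c κ : ι → ℝ) :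
    ∑ x', w * ((w * ∑ z', (∑ z, A x' z * D z z') * c z') * κ x') =
      w * ∑ z', (∑ z, (∑ x', w * (A x' z * κ x')) * D z z') * c z' := by
  have hL : ∑ x', w * ((w * ∑ z', (∑ z, A x' z * D z z') * c z') * κ x') =
      ∑ x', ∑ z', ∑ z, w * w * A x' z * D z z' * c z' * κ x' := by
    refine Finset.sum_congr rfl fun x' _ => ?_
    simp only [Finset.mul_sum, Finset.sum_mul]
    refine Finset.sum_congr rfl fun z' _ => Finset.sum_congr rfl fun z _ => ?_
    ring
  have hR : w * ∑ z', (∑ z, (∑ x', w * (A x' z * κ x')) * D z z') * c z' =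
      ∑ z', ∑ z, ∑ x', w * w * A x' z * D z z' * c z' * κ x' := by
    simp only [Finset.mul_sum, Finset.sum_mul]
    refine Finset.sum_congr rfl fun z' _ => Finset.sum_congr rfl fun z _ => Finset.sum_congr rfl fun x' _ => ?_
    ring
  rw [hL, hR, Finset.sum_comm]
  refine Finset.sum_congr rfl fun z' _ => ?_
  rw [Finset.sum_comm]

/-- **THE FUBINI FORM**: for every kernel `κ` with `|κ(x′,x)| ≤ b(ξ·max(1,|x′−x|))^{−2}e^{−βξ|x′−x|}` (all sites) and all `μ′, x`,
`|Σ_{x′}ξ^d(∂^ξ_{μ′}M)(x′,x)κ(x′,x)| ≤ K₃·b`, `K₃ = (torusConst + 472501)·S₁(γ)·6205·C_G·(1 + radialConst 3 ½ 1 0)`, `γ = ½min(δ,β)`,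
`S₁(γ) = 4e^{4γ}(1 + radialConst 3 γ 1 1) + 2e^{2γ}`.  Route: `(∂_{μ′}M)(x′,x) = ξ^dΣ_{z′}Σ_z(∂G)(x′,z)D(z,z′)C(z′,x)`; the `x′`-sum is
done FIRST, `U(z) = Σ_{x′}ξ^d(∂G)(x′,z)κ(x′,x)` is a SHARP composition `P₂ ⋆ P₂ ≤ 6205C_Gb·P₁(z,x)` (`conv22_le`); `D` preserves `P₁`
(`abs_Dmid_smear_one_le`); finally `Σ_{z′}ξ^d·P₁(z′,x)·|C^ξ_T(z′,x)| ≤ (torusConst + 472501)(1 + radialConst 3 ½ 1 0)`.  This bounds the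
(3.26) cross terms `(M∂^*_{μ′})(x,x′)(G∂^*_μ)(x′,x)` whose factors are NOT separately summable with the right power.
[cite: Balaban1983Higgs3, (3.16) p.437, (3.26) p.441] -/
theorem abs_sum_d1Mxi_mul_le (hPd : P.d = 3) (ha : 0 < a) (hmsq : 0 ≤ msq) (hk1 : 1 ≤ k) (hkK : k ≤ P.K) (hδ : 0 < δ)
    (hCG : 0 ≤ C_G)
    (hG2 : ∀ (μ : Fin P.d) (y z : Site P 0), |d1Kernel (P.eta k)⁻¹ μ (G0xi P a msq k) y z| ≤
      C_G * (((P.eta k * max (1 : ℝ) (supDist y z : ℝ)) ^ 2)⁻¹ * Real.exp (-(δ * (P.eta k * (supDist y z : ℝ))))))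
    {β b : ℝ} (hβ : 0 < β) (hb : 0 ≤ b) (κ : Kernel P 0)
    (hκ : ∀ x' x : Site P 0, |κ x' x| ≤
      b * (((P.eta k * max (1 : ℝ) (supDist x' x : ℝ)) ^ 2)⁻¹ * Real.exp (-(β * (P.eta k * (supDist x' x : ℝ))))))
    (μ' : Fin P.d) (x : Site P 0) :
    |∑ x' : Site P 0, P.eta k ^ P.d * (d1Kernel (P.eta k)⁻¹ μ' (Mxi P a msq k) x' x * κ x' x)| ≤
      (torusConst + 472501) *
          (((1 + msq) + a * (4 * Real.exp (4 * (min δ β / 2)) * 1 * (1 + radialConst 3 (min δ β / 2) 1 1) +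
              2 * Real.exp (2 * (min δ β / 2)) * 1)) * (6205 * C_G * b)) *
        (1 + radialConst 3 (1 / 2) 1 0) := by
  have hkm : k ≤ P.m + P.K := hkK.trans (Nat.le_add_left _ _)
  have hη : 0 < P.eta k := eta_pos P k
  have hη1 : P.eta k ≤ 1 := eta_le_one P k
  have hηd : 0 ≤ P.eta k ^ P.d := (pow_pos hη _).le
  have hN : 1 ≤ P.eta k * (P.sitesPerDir 0 : ℝ) := one_le_eta_mul_sitesPerDir P hkm
  have hT := torusConst_nonneg
  have hcT0 : 0 ≤ torusConst + 472501 := by linarith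
  have hγ : 0 < min δ β / 2 := by have := lt_min hδ hβ; positivity
  have hγδ : 2 * (min δ β / 2) ≤ δ := by linarith [min_le_left δ β]
  have hγβ : 2 * (min δ β / 2) ≤ β := by linarith [min_le_right δ β]
  -- the x′-sum first: U(z,x) = Σ_{x′} ξ^d (∂G)(x′,z) κ(x′,x) is a sharp composition P₂ ⋆ P₂ ≤ 6205 C_G b · P₁(z,x)
  have hU : ∀ z x : Site P 0,
      |∑ x' : Site P 0, P.eta k ^ P.d * (d1Kernel (P.eta k)⁻¹ μ' (G0xi P a msq k) x' z * κ x' x)| ≤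
        6205 * C_G * b * ((P.eta k * max (1 : ℝ) (supDist z x : ℝ))⁻¹ *
          Real.exp (-(min δ β / 2 * (P.eta k * (supDist z x : ℝ))))) := by
    intro z x
    have hconv := conv22_le hPd hη hδ hβ hγ.le hγδ hγβ hCG hb
      (fun z x' : Site P 0 => d1Kernel (P.eta k)⁻¹ μ' (G0xi P a msq k) x' z) κ
      (fun z x' => by
        show |d1Kernel (P.eta k)⁻¹ μ' (G0xi P a msq k) x' z| ≤ _
        rw [supDist_comm z x']
        exact hG2 μ' x' z) hκ z x
    calc |∑ x' : Site P 0, P.eta k ^ P.d * (d1Kernel (P.eta k)⁻¹ μ' (G0xi P a msq k) x' z * κ x' x)|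
        ≤ ∑ x' : Site P 0, |P.eta k ^ P.d * (d1Kernel (P.eta k)⁻¹ μ' (G0xi P a msq k) x' z * κ x' x)| :=
          Finset.abs_sum_le_sum_abs _ _
      _ = ∑ x' : Site P 0, P.eta k ^ P.d * (|d1Kernel (P.eta k)⁻¹ μ' (G0xi P a msq k) x' z| * |κ x' x|) :=
          Finset.sum_congr rfl fun x' _ => by rw [abs_mul, abs_mul, abs_of_nonneg hηd]
      _ ≤ _ := hconv
  -- D preserves the propagator profile
  have hV : ∀ z' x : Site P 0,
      |∑ z : Site P 0, (∑ x' : Site P 0, P.eta k ^ P.d * (d1Kernel (P.eta k)⁻¹ μ' (G0xi P a msq k) x' z * κ x' x)) *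
          Dmid P a msq k z z'| ≤
        ((1 + msq) + a * (4 * Real.exp (4 * (min δ β / 2)) * 1 * (1 + radialConst 3 (min δ β / 2) 1 1) +
            2 * Real.exp (2 * (min δ β / 2)) * 1)) * (6205 * C_G * b) *
          ((P.eta k * max (1 : ℝ) (supDist z' x : ℝ))⁻¹ * Real.exp (-(min δ β / 2 * (P.eta k * (supDist z' x : ℝ))))) := by
    intro z' x
    have hsw : ∑ z : Site P 0, (∑ x' : Site P 0, P.eta k ^ P.d *
          (d1Kernel (P.eta k)⁻¹ μ' (G0xi P a msq k) x' z * κ x' x)) * Dmid P a msq k z z' =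
        ∑ z : Site P 0, Dmid P a msq k z' z * (fun z x : Site P 0 => ∑ x' : Site P 0, P.eta k ^ P.d *
          (d1Kernel (P.eta k)⁻¹ μ' (G0xi P a msq k) x' z * κ x' x)) z x := by
      refine Finset.sum_congr rfl fun z _ => ?_
      rw [Dmid_symm a msq hkm z z', mul_comm]
    rw [hsw]
    exact abs_Dmid_smear_one_le ha hmsq hPd hk1 hkK hγ (by positivity) _ hU z' x
  -- reassemble and sum against C^ξ_T
  have hre : ∑ x' : Site P 0, P.eta k ^ P.d * (d1Kernel (P.eta k)⁻¹ μ' (Mxi P a msq k) x' x * κ x' x) =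
      P.eta k ^ P.d * ∑ z' : Site P 0, (∑ z : Site P 0, (∑ x' : Site P 0, P.eta k ^ P.d *
        (d1Kernel (P.eta k)⁻¹ μ' (G0xi P a msq k) x' z * κ x' x)) * Dmid P a msq k z z') * CxiT (P.eta k) z' x := by
    simp only [d1Kernel_Mxi ha hmsq hk1]
    exact fubini3 (P.eta k ^ P.d) _ _ (fun z' => CxiT (P.eta k) z' x) (fun x' => κ x' x)
  set B : ℝ := ((1 + msq) + a * (4 * Real.exp (4 * (min δ β / 2)) * 1 * (1 + radialConst 3 (min δ β / 2) 1 1) +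
      2 * Real.exp (2 * (min δ β / 2)) * 1)) * (6205 * C_G * b) with hB
  have hB0 : 0 ≤ B := by have := radialConst_nonneg 3 hγ zero_le_one 1; positivity
  -- the pointwise product of the two propagator profiles at the same pair is a derivative profile
  have hpt : ∀ z' : Site P 0,
      P.eta k ^ P.d * (|∑ z : Site P 0, (∑ x' : Site P 0, P.eta k ^ P.d *
          (d1Kernel (P.eta k)⁻¹ μ' (G0xi P a msq k) x' z * κ x' x)) * Dmid P a msq k z z'| * |CxiT (P.eta k) z' x|) ≤
        B * (torusConst + 472501) * (P.eta k ^ P.d * (((P.eta k * max (1 : ℝ) (supDist x z' : ℝ)) ^ 2)⁻¹ *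
          Real.exp (-(1 / 2 * (P.eta k * (supDist x z' : ℝ)))))) := by
    intro z'
    have h1 := hV z' x
    have h2 := abs_CxiT_profile hPd hη hη1 hN z' x
    rw [supDist_comm z' x] at h1 h2
    have hm0 : 0 < P.eta k * max (1 : ℝ) (supDist x z' : ℝ) := mul_pos hη (lt_max_of_lt_left one_pos)
    have he1 : Real.exp (-(min δ β / 2 * (P.eta k * (supDist x z' : ℝ)))) ≤ 1 :=
      Real.exp_le_one_iff.mpr (by have := mul_nonneg hη.le (Nat.cast_nonneg (supDist x z')); nlinarith)
    have hq0 : 0 ≤ (P.eta k * max (1 : ℝ) (supDist x z' : ℝ))⁻¹ * Real.exp (-(1 / 2 * (P.eta k * (supDist x z' : ℝ)))) := by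
      positivity
    calc P.eta k ^ P.d * (|∑ z : Site P 0, (∑ x' : Site P 0, P.eta k ^ P.d *
          (d1Kernel (P.eta k)⁻¹ μ' (G0xi P a msq k) x' z * κ x' x)) * Dmid P a msq k z z'| * |CxiT (P.eta k) z' x|)
        ≤ P.eta k ^ P.d * ((B * ((P.eta k * max (1 : ℝ) (supDist x z' : ℝ))⁻¹ *
            Real.exp (-(min δ β / 2 * (P.eta k * (supDist x z' : ℝ)))))) * ((torusConst + 472501) *
            ((P.eta k * max (1 : ℝ) (supDist x z' : ℝ))⁻¹ * Real.exp (-(1 / 2 * (P.eta k * (supDist x z' : ℝ))))))) :=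
          mul_le_mul_of_nonneg_left (mul_le_mul h1 h2 (abs_nonneg _) (by positivity)) hηd
      _ ≤ P.eta k ^ P.d * ((B * ((P.eta k * max (1 : ℝ) (supDist x z' : ℝ))⁻¹ * 1)) * ((torusConst + 472501) *
            ((P.eta k * max (1 : ℝ) (supDist x z' : ℝ))⁻¹ * Real.exp (-(1 / 2 * (P.eta k * (supDist x z' : ℝ))))))) := by
          gcongr
      _ = _ := by rw [pow_two, mul_inv]; ring
  calc |∑ x' : Site P 0, P.eta k ^ P.d * (d1Kernel (P.eta k)⁻¹ μ' (Mxi P a msq k) x' x * κ x' x)|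
      = P.eta k ^ P.d * |∑ z' : Site P 0, (∑ z : Site P 0, (∑ x' : Site P 0, P.eta k ^ P.d *
          (d1Kernel (P.eta k)⁻¹ μ' (G0xi P a msq k) x' z * κ x' x)) * Dmid P a msq k z z') * CxiT (P.eta k) z' x| := by
        rw [hre, abs_mul, abs_of_nonneg hηd]
    _ ≤ P.eta k ^ P.d * ∑ z' : Site P 0, |(∑ z : Site P 0, (∑ x' : Site P 0, P.eta k ^ P.d *
          (d1Kernel (P.eta k)⁻¹ μ' (G0xi P a msq k) x' z * κ x' x)) * Dmid P a msq k z z') * CxiT (P.eta k) z' x| :=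
        mul_le_mul_of_nonneg_left (Finset.abs_sum_le_sum_abs _ _) hηd
    _ = ∑ z' : Site P 0, P.eta k ^ P.d * (|∑ z : Site P 0, (∑ x' : Site P 0, P.eta k ^ P.d *
          (d1Kernel (P.eta k)⁻¹ μ' (G0xi P a msq k) x' z * κ x' x)) * Dmid P a msq k z z'| * |CxiT (P.eta k) z' x|) := by
        rw [Finset.mul_sum]
        exact Finset.sum_congr rfl fun z' _ => by rw [abs_mul]
    _ ≤ ∑ z' : Site P 0, B * (torusConst + 472501) * (P.eta k ^ P.d *
          (((P.eta k * max (1 : ℝ) (supDist x z' : ℝ)) ^ 2)⁻¹ * Real.exp (-(1 / 2 * (P.eta k * (supDist x z' : ℝ)))))) :=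
        Finset.sum_le_sum fun z' _ => hpt z'
    _ ≤ B * (torusConst + 472501) * (1 + radialConst P.d (1 / 2) (P.eta k) 0) := by
        rw [← Finset.mul_sum]
        exact mul_le_mul_of_nonneg_left (sum_profile_le hPd hη hη1 (by norm_num) x) (by positivity)
    _ ≤ B * (torusConst + 472501) * (1 + radialConst 3 (1 / 2) 1 0) := by
        rw [hPd]
        have := radialConst_mono 3 (by norm_num : (0 : ℝ) < 1 / 2) hη1 0
        gcongr
    _ = _ := by rw [hB]; ring

/-- **The Fubini form with the column difference** `(M∂^{ξ*}_{μ′})(x,x′) = (∂^ξ_{μ′}M)(x′,x)` — the shape in which the first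
propagator of the (3.26) graph `(G∂^*_{μ′})(x,x′)(G∂^*_μ)(x′,x)` carries `M`. [cite: Balaban1983Higgs3, (3.16) p.437, (3.26) p.441] -/
theorem abs_sum_dAdjMxi_mul_le (hPd : P.d = 3) (ha : 0 < a) (hmsq : 0 ≤ msq) (hk1 : 1 ≤ k) (hkK : k ≤ P.K) (hδ : 0 < δ)
    (hCG : 0 ≤ C_G)
    (hG2 : ∀ (μ : Fin P.d) (y z : Site P 0), |d1Kernel (P.eta k)⁻¹ μ (G0xi P a msq k) y z| ≤
      C_G * (((P.eta k * max (1 : ℝ) (supDist y z : ℝ)) ^ 2)⁻¹ * Real.exp (-(δ * (P.eta k * (supDist y z : ℝ))))))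
    {β b : ℝ} (hβ : 0 < β) (hb : 0 ≤ b) (κ : Kernel P 0)
    (hκ : ∀ x' x : Site P 0, |κ x' x| ≤
      b * (((P.eta k * max (1 : ℝ) (supDist x' x : ℝ)) ^ 2)⁻¹ * Real.exp (-(β * (P.eta k * (supDist x' x : ℝ))))))
    (μ' : Fin P.d) (x : Site P 0) :
    |∑ x' : Site P 0, P.eta k ^ P.d * (dAdjKernel (P.eta k)⁻¹ μ' (Mxi P a msq k) x x' * κ x' x)| ≤
      (torusConst + 472501) *
          (((1 + msq) + a * (4 * Real.exp (4 * (min δ β / 2)) * 1 * (1 + radialConst 3 (min δ β / 2) 1 1) +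
              2 * Real.exp (2 * (min δ β / 2)) * 1)) * (6205 * C_G * b)) *
        (1 + radialConst 3 (1 / 2) 1 0) := by
  have hkm : k ≤ P.m + P.K := hkK.trans (Nat.le_add_left _ _)
  simp only [dAdjKernel_Mxi_eq ha hmsq (by omega) hk1 hkm]
  exact abs_sum_d1Mxi_mul_le hPd ha hmsq hk1 hkK hδ hCG hG2 hβ hb κ hκ μ' x

end Bounds

/-! ## §2 The hypothesis-free package -/

/-- **THE KERNELS OF `M = G^ξ_k(0) − C^ξ_T` AT THE ZERO-FIELD TORUS INSTANCE, ALL SITES, UNIFORMLY IN THE VOLUME** (`d = 3`; the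
content of *"If at least one propagator G_{j₀}(0) is replaced by G_{j₀}(0)(1 − m²_{j₀} − a_{j₀}P_{j₀})C^ξ, then we get a convergent
expression"* for the kernels of (3.26)).  For odd `L > 1`, `a > 0`, `m² ≥ 0` there are `δ, C > 0` (functions of `L, a, m²`) such that
for EVERY `P = (3, L, m, K)`, every `1 ≤ k ≤ K` (`ξ = L^{−k}`), with `P_p(y,y′) = (ξ·max(1,|y−y′|))^{−p}e^{−δξ|y−y′|}`:
(i) `|M(y,y′)| ≤ C`; (ii) `|(∂^ξ_μM)(y,y′)| ≤ C·P₁(y,y′)`; (iii) `|(M∂^{ξ*}_μ)(y,x′)| ≤ C·P₁(y,x′)`; (iv) `|(∂^ξ_{μ′}M∂^{ξ*}_μ)(x,x′)| ≤ C·P₁(x,x′)`;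
(v)/(vi) for every kernel `κ` and `b ≥ 0` with `|κ(x′,x)| ≤ b·P₂(x′,x)`: `|Σ_{x′}ξ^d(∂^ξ_{μ′}M)(x′,x)κ(x′,x)| ≤ C·b` and
`|Σ_{x′}ξ^d(M∂^{ξ*}_{μ′})(x,x′)κ(x′,x)| ≤ C·b`. [cite: Balaban1983Higgs3, (3.16) p.437, (3.26) p.441] -/
theorem Mxi_profiles (L : ℕ) (hL : Odd L ∧ 1 < L) {a : ℝ} (ha : 0 < a) {msq : ℝ} (hmsq : 0 ≤ msq) :
    ∃ δ C : ℝ, 0 < δ ∧ 0 < C ∧ ∀ (P : Params), P.d = 3 → P.L = L → ∀ k : ℕ, 1 ≤ k → k ≤ P.K →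
      (∀ y y' : Site P 0, |Mxi P a msq k y y'| ≤ C) ∧
      (∀ (μ : Fin P.d) (y y' : Site P 0), |d1Kernel (P.eta k)⁻¹ μ (Mxi P a msq k) y y'| ≤
          C * ((P.eta k * max (1 : ℝ) (supDist y y' : ℝ))⁻¹ * Real.exp (-(δ * (P.eta k * (supDist y y' : ℝ)))))) ∧
      (∀ (μ : Fin P.d) (y x' : Site P 0), |dAdjKernel (P.eta k)⁻¹ μ (Mxi P a msq k) y x'| ≤
          C * ((P.eta k * max (1 : ℝ) (supDist y x' : ℝ))⁻¹ * Real.exp (-(δ * (P.eta k * (supDist y x' : ℝ)))))) ∧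
      (∀ (μ' μ : Fin P.d) (x x' : Site P 0), |d2Kernel (P.eta k)⁻¹ μ' μ (Mxi P a msq k) x x'| ≤
          C * ((P.eta k * max (1 : ℝ) (supDist x x' : ℝ))⁻¹ * Real.exp (-(δ * (P.eta k * (supDist x x' : ℝ)))))) ∧
      (∀ (κ : Kernel P 0) (b : ℝ), 0 ≤ b →
        (∀ x' x : Site P 0, |κ x' x| ≤
          b * (((P.eta k * max (1 : ℝ) (supDist x' x : ℝ)) ^ 2)⁻¹ * Real.exp (-(δ * (P.eta k * (supDist x' x : ℝ)))))) →
        ∀ (μ' : Fin P.d) (x : Site P 0),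
          |∑ x' : Site P 0, P.eta k ^ P.d * (d1Kernel (P.eta k)⁻¹ μ' (Mxi P a msq k) x' x * κ x' x)| ≤ C * b) ∧
      (∀ (κ : Kernel P 0) (b : ℝ), 0 ≤ b →
        (∀ x' x : Site P 0, |κ x' x| ≤
          b * (((P.eta k * max (1 : ℝ) (supDist x' x : ℝ)) ^ 2)⁻¹ * Real.exp (-(δ * (P.eta k * (supDist x' x : ℝ)))))) →
        ∀ (μ' : Fin P.d) (x : Site P 0),
          |∑ x' : Site P 0, P.eta k ^ P.d * (dAdjKernel (P.eta k)⁻¹ μ' (Mxi P a msq k) x x' * κ x' x)| ≤ C * b) := by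
  obtain ⟨δ, C_G, hδ, hCG, HG⟩ := G0xi_all_bounds L hL ha hmsq
  have hT := torusConst_nonneg
  -- the rate of the package and the four constants
  set γ : ℝ := min δ (1 / 2) / 2 with hγ
  have hγ0 : 0 < γ := by have := lt_min hδ (by norm_num : (0 : ℝ) < 1 / 2); positivity
  set S₂ : ℝ := ((1 + msq) + a * (16 * Real.exp (4 * δ) * 1 * (1 + radialConst 3 δ 1 0) + 4 * Real.exp (2 * δ) * 1)) * C_G
    with hS₂
  have hS₂0 : 0 ≤ S₂ := by have := radialConst_nonneg 3 hδ zero_le_one 0; positivity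
  set C₁ : ℝ := (1 + msq) * (C_G * (torusConst + 472501) / 2 *
      (2 + radialConst 3 (δ / 2) 1 0 + radialConst 3 (1 / 2 / 2) 1 0)) +
    a * (C_G * (torusConst + 472501) / 2 *
      ((1 + radialConst 3 (δ / 2) 1 0) * (1 + radialConst 3 (1 / 2 / 2) 1 2) +
        (1 + radialConst 3 (δ / 2) 1 2) * (1 + radialConst 3 (1 / 2 / 2) 1 0))) with hC₁
  have hC₁0 : 0 ≤ C₁ := by
    have h1 := radialConst_nonneg 3 (half_pos hδ) zero_le_one 0
    have h2 := radialConst_nonneg 3 (half_pos hδ) zero_le_one 2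
    have h3 := radialConst_nonneg 3 (by norm_num : (0 : ℝ) < 1 / 2 / 2) zero_le_one 0
    have h4 := radialConst_nonneg 3 (by norm_num : (0 : ℝ) < 1 / 2 / 2) zero_le_one 2
    positivity
  set C₂ : ℝ := (torusConst + 472501) * S₂ *
      (2 * (1 + radialConst 3 (δ / 2) 1 0) + 8 * (1 + radialConst 3 (1 / 2) 1 0) + 2 * (1 + radialConst 3 δ 1 0)) with hC₂
  have hC₂0 : 0 ≤ C₂ := by
    have h1 := radialConst_nonneg 3 (half_pos hδ) zero_le_one 0
    have h2 := radialConst_nonneg 3 hδ zero_le_one 0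
    have h3 := radialConst_nonneg 3 (by norm_num : (0 : ℝ) < 1 / 2) zero_le_one 0
    positivity
  set C₃ : ℝ := 6205 * S₂ * (3037500 + torusConst + 472501) with hC₃
  have hC₃0 : 0 ≤ C₃ := by positivity
  set C₄ : ℝ := (torusConst + 472501) *
      (((1 + msq) + a * (4 * Real.exp (4 * (min δ γ / 2)) * 1 * (1 + radialConst 3 (min δ γ / 2) 1 1) +
          2 * Real.exp (2 * (min δ γ / 2)) * 1)) * (6205 * C_G)) * (1 + radialConst 3 (1 / 2) 1 0) with hC₄
  have hC₄0 : 0 ≤ C₄ := by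
    have hm : 0 < min δ γ / 2 := by have := lt_min hδ hγ0; positivity
    have h1 := radialConst_nonneg 3 hm zero_le_one 1
    have h2 := radialConst_nonneg 3 (by norm_num : (0 : ℝ) < 1 / 2) zero_le_one 0
    positivity
  refine ⟨γ, C₁ + C₂ + C₃ + C₄ + 1, hγ0, by positivity, fun P hPd hPL k hk1 hkK => ?_⟩
  obtain ⟨hGv, hGr, -, -⟩ := HG P hPd hPL k hk1 hkK
  have hkm : k ≤ P.m + P.K := hkK.trans (Nat.le_add_left _ _)
  have hd2 : 2 ≤ P.d := by omega
  have hη : 0 < P.eta k := eta_pos P k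
  -- the generic weakening `Cᵢ·q ≤ (C₁+C₂+C₃+C₄+1)·q`
  have hup : ∀ {v Ci q : ℝ}, Ci ≤ C₁ + C₂ + C₃ + C₄ + 1 → 0 ≤ q → v ≤ Ci * q → v ≤ (C₁ + C₂ + C₃ + C₄ + 1) * q :=
    fun hCi hq h => h.trans (mul_le_mul_of_nonneg_right hCi hq)
  have hle₁ : C₁ ≤ C₁ + C₂ + C₃ + C₄ + 1 := by linarith
  have hle₂ : C₂ ≤ C₁ + C₂ + C₃ + C₄ + 1 := by linarith
  have hle₃ : C₃ ≤ C₁ + C₂ + C₃ + C₄ + 1 := by linarith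
  have hle₄ : C₄ ≤ C₁ + C₂ + C₃ + C₄ + 1 := by linarith
  have hii : ∀ (μ : Fin P.d) (y y' : Site P 0), |d1Kernel (P.eta k)⁻¹ μ (Mxi P a msq k) y y'| ≤
      (C₁ + C₂ + C₃ + C₄ + 1) * ((P.eta k * max (1 : ℝ) (supDist y y' : ℝ))⁻¹ *
        Real.exp (-(γ * (P.eta k * (supDist y y' : ℝ))))) := fun μ y y' =>
    hup hle₂ (by positivity) (by rw [hC₂, hS₂]; exact abs_d1Kernel_Mxi_le hPd ha hmsq hk1 hkK hδ hCG.le hGr μ y y')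
  refine ⟨fun y y' => ?_, hii, fun μ y x' => ?_, fun μ' μ x x' => ?_, fun κ b hb hκ μ' x => ?_, fun κ b hb hκ μ' x => ?_⟩
  · have h := abs_Mxi_le hPd ha hmsq hk1 hkK hδ hCG.le hGv y y'
    rw [← hC₁] at h
    linarith
  · rw [dAdjKernel_Mxi_eq ha hmsq hd2 hk1 hkm, supDist_comm y x']
    exact hii μ x' y
  · exact hup hle₃ (by positivity) (by rw [hC₃, hS₂]; exact abs_d2Kernel_Mxi_le hPd ha hmsq hk1 hkK hδ hCG.le hGr μ' μ x x')
  · have h := abs_sum_d1Mxi_mul_le hPd ha hmsq hk1 hkK hδ hCG.le hGr hγ0 hb κ hκ μ' x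
    have h' : |∑ x' : Site P 0, P.eta k ^ P.d * (d1Kernel (P.eta k)⁻¹ μ' (Mxi P a msq k) x' x * κ x' x)| ≤ C₄ * b :=
      h.trans (le_of_eq (by rw [hC₄]; ring))
    exact h'.trans (mul_le_mul_of_nonneg_right hle₄ hb)
  · have h := abs_sum_dAdjMxi_mul_le hPd ha hmsq hk1 hkK hδ hCG.le hGr hγ0 hb κ hκ μ' x
    have h' : |∑ x' : Site P 0, P.eta k ^ P.d * (dAdjKernel (P.eta k)⁻¹ μ' (Mxi P a msq k) x x' * κ x' x)| ≤ C₄ * b :=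
      h.trans (le_of_eq (by rw [hC₄]; ring))
    exact h'.trans (mul_le_mul_of_nonneg_right hle₄ hb)

end

end Literature.MathematicalPhysics.QuantumFieldTheory.Balaban1983to89.B3MxiFubiniBound
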